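import Summits.MatrixMultiplication.MatrixMultiplication.Theorems.AbelianSTPPCensusTAStatKMemberX2

/-!
# Static t*-certificate: splitting one node of the multi-parameter k-member tree into separately checkable pieces (data-free)

Cell mm-stpp (rung F-M1).  The kernel unit of the ranges built on `TAStatKM.rootKX` (`AbelianSTPPCensusTAStatKMemberX.lean`, vp-p2 gen 6) is one
`decide` per (maximal-member cell, order): `rootKX … M …`.  Near the wall of a tier that single tree exceeds what one `decide` can hold (T_A at the
orders `6783 … 6833`: up to 10⁶ nodes in the cell `(15,15,18)`; T_B at `≥ 5995`).  This file lets a generator prove `treeKX … = true` / `rootKX … = true` for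
ONE node from separately compiled facts about its children: case (i) of a node (`goI` over the allowed list) is a conjunction over list POSITIONS,
re-expressed as `goIR … st n` (positions `st … st+n−1`, each child still receiving the full suffix), with `goI_eq_goIR`, the range split `goIR_add`, the
one-position form `goIR_one_of_child`, and the node / root assembly lemmas `treeKX_of_parts`, `rootKX_of_parts` (unfolding `treeKX_succ` / `rootKX` once).
No soundness content: these are equalities between Bool computations; `rootKX_sound` is applied to the assembled fact exactly as before.
WHAT THIS IS NOT: no statement about STPP families, orders or `ω`.
-/

set_option linter.dupNamespace false
set_option autoImplicit false

namespace Summit.MatrixMultiplication.MatrixMultiplication.Theorems.TAStatKM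

open TECert (vol us)
open TAStat (Entry e0)

section Split

variable (gain : ℕ → ℕ)

/-- case (i) of a node restricted to the list positions `st, …, st + n − 1` of `ms` (the child at position `q` receives the suffix `ms.drop q`, as in `goI`) -/
def goIR (V : ℕ) (child : Agg → List (ℕ × ℕ × ℕ) → Bool) (A : Agg) (ms : List (ℕ × ℕ × ℕ)) : ℕ → ℕ → Bool
  | _, 0 => true
  | st, n + 1 =>
    (match ms.drop st with
      | [] => true
      | m :: rest => Nat.blt V (vol m) || child (addM (gain (vol m)) A m) (m :: rest)) && goIR V child A ms (st + 1) n

variable {gain}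

/-- `goI` over a suffix is `goIR` over the corresponding positions. [bookkeeping] -/
theorem goI_eq_goIR (V : ℕ) (child : Agg → List (ℕ × ℕ × ℕ) → Bool) (A : Agg) (ms : List (ℕ × ℕ × ℕ)) :
    ∀ (n st : ℕ), st + n = ms.length → goI gain V child A (ms.drop st) = goIR gain V child A ms st n
  | 0, st, h => by
    have hd : ms.drop st = [] := List.drop_eq_nil_iff.2 (by omega)
    rw [hd]; rfl
  | n + 1, st, h => by
    have hlt : st < ms.length := by omega
    have hd : ms.drop st = ms[st] :: ms.drop (st + 1) := List.drop_eq_getElem_cons hlt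
    have ih := goI_eq_goIR V child A ms n (st + 1) (by omega)
    show goI gain V child A (ms.drop st) = ((match ms.drop st with
      | [] => true
      | m :: rest => Nat.blt V (vol m) || child (addM (gain (vol m)) A m) (m :: rest)) && goIR gain V child A ms (st + 1) n)
    rw [hd, ← ih]
    rfl

/-- the whole list: `goI ms = goIR ms 0 |ms|` [bookkeeping] -/
theorem goI_eq_goIR_zero (V : ℕ) (child : Agg → List (ℕ × ℕ × ℕ) → Bool) (A : Agg) (ms : List (ℕ × ℕ × ℕ)) :
    goI gain V child A ms = goIR gain V child A ms 0 ms.length := by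
  have := goI_eq_goIR (gain := gain) V child A ms ms.length 0 (by omega)
  simpa using this

/-- splitting a position range [bookkeeping] -/
theorem goIR_add (V : ℕ) (child : Agg → List (ℕ × ℕ × ℕ) → Bool) (A : Agg) (ms : List (ℕ × ℕ × ℕ)) :
    ∀ (a st b : ℕ), goIR gain V child A ms st (a + b) = (goIR gain V child A ms st a && goIR gain V child A ms (st + a) b)
  | 0, st, b => by simp [goIR]
  | a + 1, st, b => by
    rw [show a + 1 + b = (a + b) + 1 by omega]
    show ((match ms.drop st with
      | [] => true
      | m :: rest => Nat.blt V (vol m) || child (addM (gain (vol m)) A m) (m :: rest)) && goIR gain V child A ms (st + 1) (a + b)) =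
      (((match ms.drop st with
      | [] => true
      | m :: rest => Nat.blt V (vol m) || child (addM (gain (vol m)) A m) (m :: rest)) && goIR gain V child A ms (st + 1) a) &&
        goIR gain V child A ms (st + (a + 1)) b)
    rw [goIR_add V child A ms a (st + 1) b, show st + 1 + a = st + (a + 1) by omega, Bool.and_assoc]

/-- two passing adjacent position ranges give the joined range [bookkeeping] -/
theorem goIR_append {V : ℕ} {child : Agg → List (ℕ × ℕ × ℕ) → Bool} {A : Agg} {ms : List (ℕ × ℕ × ℕ)} {st a b : ℕ}
    (h1 : goIR gain V child A ms st a = true) (h2 : goIR gain V child A ms (st + a) b = true) :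
    goIR gain V child A ms st (a + b) = true := by
  rw [goIR_add, h1, h2]; rfl

/-- one position from its child's fact: if `ms.drop q = m :: rest` and the child of `m` passes on that suffix, the range `[q, q+1)` passes [bookkeeping] -/
theorem goIR_one_of_child {V : ℕ} {child : Agg → List (ℕ × ℕ × ℕ) → Bool} {A : Agg} {ms : List (ℕ × ℕ × ℕ)} {q : ℕ}
    {m : ℕ × ℕ × ℕ} {rest : List (ℕ × ℕ × ℕ)} (hd : ms.drop q = m :: rest)
    (hc : child (addM (gain (vol m)) A m) (m :: rest) = true) : goIR gain V child A ms q 1 = true := by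
  show ((match ms.drop q with
      | [] => true
      | m :: rest => Nat.blt V (vol m) || child (addM (gain (vol m)) A m) (m :: rest)) && goIR gain V child A ms (q + 1) 0) = true
  rw [hd]
  simp [goIR, hc]

/-- the whole case (i) from the full position range [bookkeeping] -/
theorem goI_of_goIR {V : ℕ} {child : Agg → List (ℕ × ℕ × ℕ) → Bool} {A : Agg} {ms : List (ℕ × ℕ × ℕ)} {n : ℕ} (hn : n = ms.length)
    (h : goIR gain V child A ms 0 n = true) : goI gain V child A ms = true := by
  rw [goI_eq_goIR_zero, ← hn]; exact h

variable (tb : ℕ → ℕ) (m2 : ℕ → List (ℕ × ℕ × ℕ)) (gain' : ℕ → ℕ) (row : ℕ → Entry) (xrow : ℕ → List (ℕ × ℕ × ℕ))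

/-- **A node from its parts** (bucket `j' + 1`): case (i) established (e.g. from `goIR` pieces) and the descent child's fact give the node. [bookkeeping] -/
theorem treeKX_of_parts {g p V d al tl M kmax n : ℕ} {A : Agg} {j' : ℕ} {ms : List (ℕ × ℕ × ℕ)}
    (hk : Nat.blt A.2.2.2.2.2 kmax = true)
    (hgo : goI gain' V (fun A' ms' => treeKX tb m2 gain' row xrow g p V d al tl M kmax n A' (j' + 1) ms') A ms = true)
    (hdesc : treeKX tb m2 gain' row xrow g p V d al tl M kmax n A j' (m2 j') = true) :
    treeKX tb m2 gain' row xrow g p V d al tl M kmax (n + 1) A (j' + 1) ms = true := by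
  have hunf : treeKX tb m2 gain' row xrow g p V d al tl M kmax (n + 1) A (j' + 1) ms =
      (testKX g p V d al tl A (tb (j' + 1)) (tb (j' + 1)) M (row (j' + 1)) false (xrow (j' + 1)) ||
        ((Nat.blt A.2.2.2.2.2 kmax && goI gain' V (fun A' ms' => treeKX tb m2 gain' row xrow g p V d al tl M kmax n A' (j' + 1) ms') A ms) &&
          treeKX tb m2 gain' row xrow g p V d al tl M kmax n A j' (m2 j'))) := rfl
  rw [hunf, hk, hgo, hdesc]; simp

/-- a node at bucket `0` from its parts: there case (ii) is `false`, so the node passes only by its test or is assembled one level up; this form covers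
the node TEST passing (any bucket). [bookkeeping] -/
theorem treeKX_of_test {g p V d al tl M kmax n : ℕ} {A : Agg} {j : ℕ} {ms : List (ℕ × ℕ × ℕ)}
    (ht : testKX g p V d al tl A (tb j) (tb j) M (row j) false (xrow j) = true) :
    treeKX tb m2 gain' row xrow g p V d al tl M kmax (n + 1) A j ms = true := by
  rw [treeKX_succ, ht]; simp

/-- **The root from its parts** (bucket `j' + 1`, own bucket `j0`): case (i) over the complete list and — unless `j0 < j' + 1` — the descent child. [bookkeeping] -/
theorem rootKX_of_parts {g p V d al tl M kmax j' j0 : ℕ}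
    (hgo : goI gain' V (fun A' ms' => treeKX tb m2 gain' row xrow g p V d al tl M kmax (kmax + (j' + 1) + 1) A' (j' + 1) ms') agg0 (m2 (j' + 1)) = true)
    (hdesc : j0 < j' + 1 ∨ treeKX tb m2 gain' row xrow g p V d al tl M kmax (kmax + (j' + 1) + 1) agg0 j' (m2 j') = true) :
    rootKX tb m2 gain' row xrow g p V d al tl M kmax (j' + 1) j0 = true := by
  simp only [rootKX, Bool.or_eq_true, Bool.and_eq_true, Nat.blt_eq]
  exact Or.inr ⟨hgo, hdesc⟩

/-- the tree cover of an order interval from per-order root facts [bookkeeping] -/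
theorem coverKX_of_forall {g p V d al tl kmax j j0 L H : ℕ}
    (h : ∀ k, k < H + 1 - L → rootKX tb m2 gain' row xrow g p V d al tl (L + k) kmax j j0 = true) :
    coverKX tb m2 gain' row xrow g p V d al tl kmax j j0 L H = true := by
  simp only [coverKX, List.all_eq_true, List.mem_range]
  exact h

/-- splitting an order interval of the tree cover in two [bookkeeping] -/
theorem coverKX_append {g p V d al tl kmax j j0 L K H : ℕ} (hLK : L ≤ K + 1) (hKH : K ≤ H)
    (h1 : coverKX tb m2 gain' row xrow g p V d al tl kmax j j0 L K = true)
    (h2 : coverKX tb m2 gain' row xrow g p V d al tl kmax j j0 (K + 1) H = true) :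
    coverKX tb m2 gain' row xrow g p V d al tl kmax j j0 L H = true := by
  simp only [coverKX, List.all_eq_true, List.mem_range] at h1 h2 ⊢
  intro k hk
  by_cases hc : L + k ≤ K
  · exact h1 k (by omega)
  · have := h2 (L + k - (K + 1)) (by omega)
    rwa [show K + 1 + (L + k - (K + 1)) = L + k by omega] at this

end Split

end Summit.MatrixMultiplication.MatrixMultiplication.Theorems.TAStatKM
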